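import Summits.BirchSwinnertonDyer.BirchSwinnertonDyer.Theorems.ManinLocalTwoThreeBracketSturmOneTwentyA
import Summits.BirchSwinnertonDyer.BirchSwinnertonDyer.Theorems.ManinLocalTwoThreeBracketSturmOneTwentyB
import HarnessLib

/-!
# LEVEL 120 = 2³·3·5 COMPLETE, fact-free: `|c| = 1` (hence `2 ∤ c`) for every lattice-optimal `X₀(120)`-datum — conductor exponent THREE at `2`

Cell bsd-f2-manin, route `ManinLocalTwoThree`, crux C2 `ManinOddAtFour` (stmt-BirchSwinnertonDyer-22967; `4 ∣ 120`, indeed `8 ∥ 120`), prover seat p3 gen 26.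
The two classes `120a`, `120b` are closed in `…BracketSturmOneTwentyA/B` (an g56's `S₂`-pinning + this seat's sparse tables, cusp-form bridge and STAGED weight-12
certificates at depth 289); here: the row dichotomy `a₅(W) = −1 ∨ a₅(W) = 1` and THE HEADLINE **`abs_maninConstant_eq_one_oneTwenty`** — `|c| = 1` for every
globally minimal elliptic `W/ℚ` and EVERY `X₀(120)`-datum with the lattice clause; `not_dvd_maninConstant_oneTwenty`; the crux shape `maninOddAtFour_oneTwenty`
(`2² ∣ 120 ∧ ∀ …, |c| = 1 ∧ 2 ∤ c`) and, since `3 ∣ 120` is NOT `9 ∣ 120`, no C3 statement (the level is outside the C3 domain).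

HONEST FRAMING: unconditional (standard axioms), no modularity, no CDT, no printed Manin fact, no Cremona table; ONE LEVEL of the C2 domain — nothing
here proves C2 (∀ N), C3, Manin's conjecture or BSD; items 22967/22968 stay OPEN.  No definition, no named fact, no sorry.
[cite: Manin1972, Prop. 1.4] [cite: Sturm1987, Thm. 1] [cite: AgasheRibetStein2006, §§1–2] [cite: CremonaAlgorithms1997, Table 1 (120a, 120b)]
-/

set_option autoImplicit false
-- lint-debt: the directory name repeats the summit name (sibling precedent `ManinLocalTwoThreeManinConstantNinety.lean`)
set_option linter.dupNamespace false

noncomputable section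

open Complex
open scoped MatrixGroups ModularForm
open ModularForm CongruenceSubgroup
open Literature.NumberTheory.EllipticCurves Literature.NumberTheory.EllipticCurves.ModularForms

namespace Summit.BirchSwinnertonDyer.BirchSwinnertonDyer.Theorems.ManinLocalTwoThree.LevelOneTwenty

open PinningKernel PinningOneTwenty

variable {W : WeierstrassCurve ℚ} [W.IsElliptic]

/-- **The two truth rows**: for every `X₀(120)`-datum, `a₅(W) = −1` (`120b`) or `a₅(W) = 1` (`120a`). [cite: CremonaAlgorithms1997, Table 1 (120a, 120b)] -/
theorem row_cases (D : ModularParametrizationData W 120) : W.LFunction 5 = -1 ∨ W.LFunction 5 = 1 := by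
  obtain ⟨S, C, -, -, c, hc, htruth, -⟩ := pinning_cusp D
  rw [show stages.map Prod.fst = [2, 3, 5, 11, 7, 13, 17, 19, 23, 29, 31] from by decide] at htruth
  have h5 := congrArg (fun l : List (ℕ × ℤ) ↦ (l.getD 2 (0, 0)).2) htruth
  simp only [goodCerts, List.mem_cons, List.mem_nil_iff, or_false] at hc
  rcases hc with rfl | rfl
  · exact Or.inl (by simpa [truth] using h5)
  · exact Or.inr (by simpa [truth] using h5)

/-- **LEVEL 120 COMPLETE — `|c| = 1` for every globally minimal elliptic `W/ℚ` and every `X₀(120)`-datum with the lattice clause** (the shape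
`LevelManinOne 120`).  No modularity, no CDT, no printed Manin fact, no Cremona table. [cite: Manin1972, Prop. 1.4] [cite: AgasheRibetStein2006, §§1–2] -/
theorem abs_maninConstant_eq_one_oneTwenty (W : WeierstrassCurve ℚ) [W.IsElliptic] [W.IsGloballyMinimal]
    (D : ModularParametrizationData W 120) (hopt : ∀ z ∈ D.L.lattice, ∃ w ∈ periodLattice D.f, z = D.c * w) :
    |D.maninConstant| = 1 := by
  rcases row_cases D with h | h
  · exact abs_maninConstant_eq_one_b W D h hopt
  · exact abs_maninConstant_eq_one_a W D h hopt

/-- **Corollary: no integer `p` with `|p| ≠ 1` — in particular neither `2` nor `3` nor any prime — divides the Manin constant of a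
lattice-optimal `X₀(120)`-datum.** [folklore] -/
theorem not_dvd_maninConstant_oneTwenty (W : WeierstrassCurve ℚ) [W.IsElliptic] [W.IsGloballyMinimal]
    (D : ModularParametrizationData W 120) (hopt : ∀ z ∈ D.L.lattice, ∃ w ∈ periodLattice D.f, z = D.c * w)
    {p : ℤ} (hp : p.natAbs ≠ 1) : ¬ p ∣ D.maninConstant := by
  intro h
  have h1 := abs_maninConstant_eq_one_oneTwenty W D hopt
  have hn : D.maninConstant.natAbs = 1 := by
    rw [Int.abs_eq_natAbs] at h1
    exact_mod_cast h1
  have h2 : p.natAbs ∣ 1 := hn ▸ Int.natAbs_dvd_natAbs.mpr h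
  exact hp (Nat.dvd_one.mp h2)

/-- **C2 `ManinOddAtFour` AT THE LEVEL `N = 120`, with NONE of its printed hypotheses**: `2² ∣ 120` and every lattice-optimal `X₀(120)`-datum of every
globally minimal elliptic curve has `|c| = 1` and `2 ∤ c`. [cite: CremonaAlgorithms1997, Table 1 (120a, 120b)] -/
theorem maninOddAtFour_oneTwenty : 2 ^ 2 ∣ 120 ∧
    ∀ (W : WeierstrassCurve ℚ) [W.IsElliptic] [W.IsGloballyMinimal] (D : ModularParametrizationData W 120),
      (∀ z ∈ D.L.lattice, ∃ w ∈ periodLattice D.f, z = D.c * w) →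
        |D.maninConstant| = 1 ∧ ¬ (2 : ℤ) ∣ D.maninConstant :=
  ⟨by norm_num, fun W _ _ D hopt ↦
    ⟨abs_maninConstant_eq_one_oneTwenty W D hopt, not_dvd_maninConstant_oneTwenty W D hopt (by decide)⟩⟩

/-- **The stage data as a by-product: `a₂(W) = 0`, `a₃(W) = 1` for every elliptic `W/ℚ` with an `X₀(120)`-datum** (both truth rows start `(2,0),(3,1)`:
additive-type vanishing at `2` is NOT claimed — `8 ∥ 120` — only the value of the stage sieve). [cite: CremonaAlgorithms1997, Table 1 (120a, 120b)] -/
theorem lFunction_two_three (D : ModularParametrizationData W 120) : W.LFunction 2 = 0 ∧ W.LFunction 3 = 1 := by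
  obtain ⟨S, C, -, -, c, hc, htruth, -⟩ := pinning_cusp D
  rw [show stages.map Prod.fst = [2, 3, 5, 11, 7, 13, 17, 19, 23, 29, 31] from by decide] at htruth
  have h2 := congrArg (fun l : List (ℕ × ℤ) ↦ (l.getD 0 (0, 0)).2) htruth
  have h3 := congrArg (fun l : List (ℕ × ℤ) ↦ (l.getD 1 (0, 0)).2) htruth
  simp only [goodCerts, List.mem_cons, List.mem_nil_iff, or_false] at hc
  rcases hc with rfl | rfl
  · exact ⟨by simpa [truth] using h2, by simpa [truth] using h3⟩
  · exact ⟨by simpa [truth] using h2, by simpa [truth] using h3⟩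

end Summit.BirchSwinnertonDyer.BirchSwinnertonDyer.Theorems.ManinLocalTwoThree.LevelOneTwenty

end
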